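import Mathlib
import Literature.Algebra.Polynomial.LaplacianOrthogonalInvariance
import Literature.AlgebraicGeometry.PlaneCurves.HessianFlexCriterion
import HarnessLib

/-!
# LEMMA 2D («TorusTransverse», piece TR3 of the LEAD's TorusReduction route for `:146 stub_oddModeRigidity`, crux ⟨stmt-QuantumFields-23035⟩)

A homogeneous polynomial `Y ∈ ℝ[x₀,x₁,x₂]` of degree `n ≥ 1` with `3 ∤ n` which is harmonic (`Σᵢ ∂ᵢ²Y = 0`), killed by
`D = ∂₀+∂₁+∂₂` (translation invariant along `(1,1,1)`) and invariant under the coordinate permutations is `0`.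

Proof (discrete Fourier transform of the three coordinates).  Over `ℂ`, substitute `xᵢ = Σⱼ ω^{ij} yⱼ` (`ω = e^{2πi/3}`),
`F := Y ∘ M`.  The chain rule gives `∂_{y₀} F = (DY) ∘ M = 0` and `∂_{y₂}∂_{y₁} F = Σ ω^{i+2i'} (∂_{i'}∂_i Y) ∘ M = 0`
(using `ΔY = 0`, `D²Y = 0`, `1 + ω + ω² = 0`), so every coefficient of `F` off the two monomials `y₁ⁿ`, `y₂ⁿ` vanishes.  The
cyclic permutation of `(x₀,x₁,x₂)` reads `y ↦ (y₀, ω y₁, ω² y₂)` in the new coordinates, so invariance forces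
`(ωⁿ − 1)·coeff(y₁ⁿ) = 0` and `(ω²ⁿ − 1)·coeff(y₂ⁿ) = 0`, i.e. `F = 0` when `3 ∤ n`; `M` is invertible (`M·N = 3`, `N_{ij} = ω^{2ij}`),
so `Y = 0`.  Only the 3-cycle is used from the permutation invariance.

Mathlib + `Literature.Algebra.Polynomial.LaplacianOrthogonalInvariance` (`linSubst`, chain rule) + the tree's `pderiv_pderiv_comm`; no `sorry`,
no new definitions (the cube root `ζ` and the DFT matrices are parameters / local terms).
HONEST LABEL: an elementary helper lemma (piece TR3 of LEAD ym-line-sfw-p2 g76's route to `TorusReduction`); `TorusReduction`,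
`AnalyticHalf`, `:146`, ⟨23035⟩, ⟨23125⟩ and every summit are OPEN; the Yang–Mills mass gap is NOT proved.  Width seat
`ym-line-sfw-p2-w5` g20 (cell ym-idea-1, free hands).
-/

set_option autoImplicit false

noncomputable section

namespace Summit.QuantumFields.YangMills.Theorems.F4SubCurvatureDoorTorusTransverse

open MvPolynomial
open scoped BigOperators
open Literature.Algebra.Polynomial (linSubst eval_bind₁_linSubst pderiv_bind₁_linSubst isHomogeneous_bind₁_linSubst)

/-! ## §0 A primitive cube root of unity -/

/-- There is a primitive cube root of unity in `ℂ` (`e^{2πi/3}`). -/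
theorem exists_isPrimitiveRoot_three : ∃ ζ : ℂ, IsPrimitiveRoot ζ 3 :=
  ⟨_, Complex.isPrimitiveRoot_exp 3 (by norm_num)⟩

/-- `1 + ζ + ζ² = 0` for a primitive cube root of unity. -/
theorem one_add_add_sq_eq_zero {ζ : ℂ} (hζ : IsPrimitiveRoot ζ 3) : 1 + ζ + ζ ^ 2 = 0 := by
  have h := hζ.geom_sum_eq_zero (by norm_num : 1 < 3)
  simpa [Finset.sum_range_succ, add_assoc] using h

/-- `ζᵏ ≠ 1` when `3 ∤ k`. -/
theorem pow_ne_one_of_not_dvd {ζ : ℂ} (hζ : IsPrimitiveRoot ζ 3) {k : ℕ} (hk : ¬ 3 ∣ k) : ζ ^ k ≠ 1 := by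
  rw [Ne, hζ.pow_eq_one_iff_dvd]
  exact hk

/-! ## §1 Generic `MvPolynomial` facts -/

section Generic

variable {σ : Type*} {R : Type*} [CommSemiring R]

/-- If the coefficient of `x^{d - eᵢ}` in `∂ᵢ p` vanishes and `dᵢ ≠ 0` then the coefficient of `x^d` in `p` vanishes
(characteristic zero). -/
theorem coeff_eq_zero_of_coeff_pderiv [CharZero R] [NoZeroDivisors R] {i : σ} {p : MvPolynomial σ R}
    {d : σ →₀ ℕ} (hd : d i ≠ 0) (h : coeff (d - Finsupp.single i 1) (pderiv i p) = 0) : coeff d p = 0 := by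
  classical
  obtain ⟨k, hk⟩ := Nat.exists_eq_succ_of_ne_zero hd
  rw [coeff_pderiv] at h
  have hds : (d - Finsupp.single i 1 : σ →₀ ℕ) + Finsupp.single i 1 = d := by
    ext j
    by_cases hj : i = j
    · subst hj; simp [hk]
    · rw [Finsupp.add_apply, Finsupp.tsub_apply, Finsupp.single_apply, if_neg hj, tsub_zero, add_zero]
  rw [hds] at h
  have hne : (((d - Finsupp.single i 1 : σ →₀ ℕ) i : R) + 1) ≠ 0 := by
    rw [← Nat.cast_succ]
    exact Nat.cast_ne_zero.mpr (Nat.succ_ne_zero _)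
  exact (mul_eq_zero.mp h).resolve_right hne

/-- A diagonal substitution `xⱼ ↦ cⱼ·xⱼ` multiplies the coefficient of `x^d` by `Πⱼ cⱼ^{dⱼ}`. -/
theorem coeff_bind₁_diag [Fintype σ] (c : σ → R) (p : MvPolynomial σ R) (d : σ →₀ ℕ) :
    coeff d (bind₁ (fun j => C (c j) * X j) p) = (∏ j, c j ^ d j) * coeff d p := by
  classical
  induction p using MvPolynomial.induction_on' with
  | monomial e a =>
    rw [bind₁_monomial]
    have h1 : (∏ j ∈ e.support, (C (c j) * X j : MvPolynomial σ R) ^ e j)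
        = (∏ j ∈ e.support, C (c j ^ e j)) * ∏ j ∈ e.support, (X j : MvPolynomial σ R) ^ e j := by
      rw [← Finset.prod_mul_distrib]
      exact Finset.prod_congr rfl (fun j _ => by rw [mul_pow, map_pow])
    have h2 : (∏ j ∈ e.support, C (c j ^ e j) : MvPolynomial σ R) = C (∏ j, c j ^ e j) := by
      rw [map_prod]
      refine Finset.prod_subset (Finset.subset_univ _) (fun j _ hj => ?_)
      rw [Finsupp.notMem_support_iff.mp hj, pow_zero, map_one]
    have h3 : (∏ j ∈ e.support, (X j : MvPolynomial σ R) ^ e j) = monomial e 1 := by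
      rw [monomial_eq, C_1, one_mul, Finsupp.prod]
    rw [h1, h2, h3, ← mul_assoc, ← map_mul, C_mul_monomial, mul_one, coeff_monomial, coeff_monomial]
    by_cases h : e = d
    · subst h; simp [mul_comm]
    · simp [h]
  | add p q hp hq => simp only [map_add, coeff_add, hp, hq, mul_add]

/-- The linear substitution of a diagonal matrix is the diagonal substitution. -/
theorem linSubst_diagonal [Fintype σ] [DecidableEq σ] {S : Type*} [CommRing S] (c : σ → S) :
    linSubst (Matrix.diagonal c) = fun j => C (c j) * X j := by
  funext j
  simp only [linSubst, Matrix.diagonal_apply]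
  rw [Finset.sum_eq_single j]
  · simp
  · intro k _ hk; simp [Ne.symm hk]
  · intro h; exact absurd (Finset.mem_univ j) h

end Generic

/-! ## §2 The discrete Fourier substitution (matrices `ζ^{ij}`, `ζ^{2ij}`, `diag(1,ζ,ζ²)` as explicit terms) -/

/-- `M (N x) = 3 x` for `M i j = ζ^{ij}`, `N i j = ζ^{2ij}` (`ζ³ = 1`, `1 + ζ + ζ² = 0`). -/
theorem dft_mulVec_dftInv {ζ : ℂ} (h3 : ζ ^ 3 = 1) (hs : 1 + ζ + ζ ^ 2 = 0) (x : Fin 3 → ℂ) :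
    (Matrix.of fun i j : Fin 3 => ζ ^ (i.val * j.val)).mulVec
        ((Matrix.of fun i j : Fin 3 => ζ ^ (2 * (i.val * j.val))).mulVec x) = (3 : ℂ) • x := by
  funext i
  fin_cases i <;>
    simp [Matrix.mulVec, dotProduct, Fin.sum_univ_three]
  · linear_combination (x 1 + x 2) * hs + (ζ * x 1 + ζ * x 2 + (ζ ^ 3 + 1) * ζ ^ 2 * x 2) * h3
  · linear_combination x 0 * hs + ((ζ ^ 3 + 2) * x 1) * h3 + x 2 * hs + (ζ ^ 2 * x 2 + (ζ ^ 6 + ζ ^ 3 + 1) * ζ * x 2) * h3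
  · linear_combination (x 0 + x 1) * hs + (ζ * x 0 + ζ * x 1 + (ζ ^ 3 + 1) * ζ ^ 2 * x 1) * h3 +
      ((ζ ^ 3 + 1) * x 2 + (ζ ^ 9 + ζ ^ 6 + ζ ^ 3 + 1) * x 2) * h3

/-- The 3-cycle `(x₀,x₁,x₂) ↦ (x₁,x₂,x₀)` reads `y ↦ (y₀, ζy₁, ζ²y₂)` in the coordinates `xᵢ = Σⱼ ζ^{ij} yⱼ`. -/
theorem dft_mulVec_twist {ζ : ℂ} (h3 : ζ ^ 3 = 1) (y : Fin 3 → ℂ) :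
    (Matrix.of fun i j : Fin 3 => ζ ^ (i.val * j.val)).mulVec ((Matrix.diagonal fun j : Fin 3 => ζ ^ j.val).mulVec y) =
      (Matrix.of fun i j : Fin 3 => ζ ^ (i.val * j.val)).mulVec y ∘ finRotate 3 := by
  have hc0 : finRotate 3 0 = 1 := by decide
  have hc1 : finRotate 3 1 = 2 := by decide
  have hc2 : finRotate 3 2 = 0 := by decide
  funext i
  fin_cases i
  · simp [Matrix.mulVec, dotProduct, Fin.sum_univ_three, Matrix.diagonal, hc0]
  · simp [Matrix.mulVec, dotProduct, Fin.sum_univ_three, Matrix.diagonal, hc1]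
    ring
  · simp [Matrix.mulVec, dotProduct, Fin.sum_univ_three, Matrix.diagonal, hc2]
    linear_combination y 1 * h3 + (ζ ^ 3 + 1) * y 2 * h3

/-! ## §3 The lemma -/

/-- **LEMMA 2D** (piece TR3 of the TorusReduction route): a homogeneous harmonic polynomial of degree `n ≥ 1`, `3 ∤ n`, on
`ℝ³`, killed by `∂₀+∂₁+∂₂` and invariant under the coordinate permutations, vanishes. -/
theorem transverse_harmonic_eq_zero (n : ℕ) (hn1 : 1 ≤ n) (hn3 : ¬ 3 ∣ n) (Y : MvPolynomial (Fin 3) ℝ)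
    (hY : Y.IsHomogeneous n) (hlap : ∑ i, pderiv i (pderiv i Y) = 0) (hD : ∑ i, pderiv i Y = 0)
    (hperm : ∀ σ : Equiv.Perm (Fin 3), rename σ Y = Y) : Y = 0 := by
  -- Step 0: a primitive cube root `ζ`; complexify.
  obtain ⟨ζ, hζ⟩ := exists_isPrimitiveRoot_three
  have h3 : ζ ^ 3 = 1 := hζ.pow_eq_one
  have hs : 1 + ζ + ζ ^ 2 = 0 := one_add_add_sq_eq_zero hζ
  set M : Matrix (Fin 3) (Fin 3) ℂ := Matrix.of fun i j : Fin 3 => ζ ^ (i.val * j.val) with hMdef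
  set Yc : MvPolynomial (Fin 3) ℂ := map Complex.ofRealHom Y with hYc
  have hYc_hom : Yc.IsHomogeneous n := hY.map _
  have hDc : ∑ i, pderiv i Yc = 0 := by
    have h := congrArg (map Complex.ofRealHom) hD
    rw [map_sum, map_zero] at h
    simpa only [← pderiv_map] using h
  have hlapc : ∑ i, pderiv i (pderiv i Yc) = 0 := by
    have h := congrArg (map Complex.ofRealHom) hlap
    rw [map_sum, map_zero] at h
    simpa only [← pderiv_map] using h
  have hD2c : ∑ i', ∑ i, pderiv i' (pderiv i Yc) = 0 := by
    have h : ∑ i', pderiv i' (∑ i, pderiv i Yc) = 0 := by rw [hDc]; simp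
    simpa only [map_sum] using h
  have hpermc : rename (finRotate 3) Yc = Yc := by
    rw [hYc, ← map_rename, hperm]
  -- Step 1: the substituted polynomial `F = Y ∘ M`.
  set F : MvPolynomial (Fin 3) ℂ := bind₁ (linSubst M) Yc with hF
  have hF_hom : F.IsHomogeneous n := isHomogeneous_bind₁_linSubst M hYc_hom
  -- Step 2: `∂₀ F = (DY) ∘ M = 0`.
  have hF0 : pderiv 0 F = 0 := by
    rw [hF, pderiv_bind₁_linSubst]
    have hMi0 : ∀ i : Fin 3, M i 0 = 1 := by intro i; simp [M]
    simp only [hMi0, map_one, one_mul]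
    rw [← map_sum, hDc, map_zero]
  -- Step 3: `∂₂ ∂₁ F = 0`.
  have hF21 : pderiv 2 (pderiv 1 F) = 0 := by
    have R1 : bind₁ (linSubst M) (pderiv 0 (pderiv 0 Yc)) + bind₁ (linSubst M) (pderiv 1 (pderiv 1 Yc)) +
        bind₁ (linSubst M) (pderiv 2 (pderiv 2 Yc)) = 0 := by
      have h := congrArg (bind₁ (linSubst M)) hlapc
      rw [map_sum, map_zero] at h
      simpa only [Fin.sum_univ_three] using h
    have R2 := congrArg (bind₁ (linSubst M)) hD2c
    rw [map_sum, map_zero] at R2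
    simp only [Fin.sum_univ_three] at R2
    have R3a : bind₁ (linSubst M) (pderiv 1 (pderiv 0 Yc)) = bind₁ (linSubst M) (pderiv 0 (pderiv 1 Yc)) :=
      congrArg _ (Literature.AlgebraicGeometry.PlaneCurves.pderiv_pderiv_comm 1 0 Yc)
    have R3b : bind₁ (linSubst M) (pderiv 2 (pderiv 0 Yc)) = bind₁ (linSubst M) (pderiv 0 (pderiv 2 Yc)) :=
      congrArg _ (Literature.AlgebraicGeometry.PlaneCurves.pderiv_pderiv_comm 2 0 Yc)
    have R3c : bind₁ (linSubst M) (pderiv 2 (pderiv 1 Yc)) = bind₁ (linSubst M) (pderiv 1 (pderiv 2 Yc)) :=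
      congrArg _ (Literature.AlgebraicGeometry.PlaneCurves.pderiv_pderiv_comm 2 1 Yc)
    have H3 : (C ζ : MvPolynomial (Fin 3) ℂ) ^ 3 = 1 := by rw [← map_pow, h3, map_one]
    have HS : 1 + (C ζ : MvPolynomial (Fin 3) ℂ) + C ζ ^ 2 = 0 := by
      have h := congrArg (C : ℂ → MvPolynomial (Fin 3) ℂ) hs
      simpa using h
    simp only [map_add] at R2
    have hM : ∀ i j : Fin 3, M i j = ζ ^ (i.val * j.val) := fun i j => rfl
    rw [hF, pderiv_bind₁_linSubst]
    simp only [Fin.sum_univ_three, map_add, pderiv_C_mul, pderiv_bind₁_linSubst]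
    simp only [hM, Fin.val_zero, Fin.val_one, Fin.val_two, zero_mul, one_mul, mul_one,
      pow_zero, pow_one, map_one, map_pow]
    set Ω : MvPolynomial (Fin 3) ℂ := C ζ
    set a00 := bind₁ (linSubst M) (pderiv 0 (pderiv 0 Yc))
    set a01 := bind₁ (linSubst M) (pderiv 0 (pderiv 1 Yc))
    set a02 := bind₁ (linSubst M) (pderiv 0 (pderiv 2 Yc))
    set a10 := bind₁ (linSubst M) (pderiv 1 (pderiv 0 Yc))
    set a11 := bind₁ (linSubst M) (pderiv 1 (pderiv 1 Yc))
    set a12 := bind₁ (linSubst M) (pderiv 1 (pderiv 2 Yc))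
    set a20 := bind₁ (linSubst M) (pderiv 2 (pderiv 0 Yc))
    set a21 := bind₁ (linSubst M) (pderiv 2 (pderiv 1 Yc))
    set a22 := bind₁ (linSubst M) (pderiv 2 (pderiv 2 Yc))
    apply mul_left_cancel₀ (two_ne_zero : (2 : MvPolynomial (Fin 3) ℂ) ≠ 0)
    linear_combination 3 * R1 - R2 + (2 * Ω ^ 2 + 1) * R3a + (2 * Ω ^ 4 + 1) * R3b + (2 * Ω ^ 5 + 1) * R3c +
      (2 * a11 + 2 * (Ω ^ 3 + 1) * a22 + 2 * Ω * (a02 + a12) + 2 * Ω ^ 2 * a12) * H3 + 2 * (a01 + a02 + a12) * HS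
  -- Step 4: all coefficients of `F` off `y₁ⁿ`, `y₂ⁿ` vanish.
  have hcoeff : ∀ d : Fin 3 →₀ ℕ, d ≠ Finsupp.single 1 n → d ≠ Finsupp.single 2 n → coeff d F = 0 := by
    intro d h1 h2
    by_cases hd0 : d 0 ≠ 0
    · exact coeff_eq_zero_of_coeff_pderiv hd0 (by rw [hF0, coeff_zero])
    push Not at hd0
    by_cases hd1 : d 1 = 0
    · by_cases hd2 : d 2 = 0
      · -- `d = 0`, degree `0 ≠ n`
        refine hF_hom.coeff_eq_zero ?_
        rw [Finsupp.degree_eq_sum, Fin.sum_univ_three, hd0, hd1, hd2]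
        omega
      · -- only `y₂` occurs: `d = single 2 (d 2)`, degree forces `d 2 = n`
        refine hF_hom.coeff_eq_zero ?_
        rw [Finsupp.degree_eq_sum, Fin.sum_univ_three, hd0, hd1]
        intro hdeg
        apply h2
        ext j
        fin_cases j <;> simp [hd0, hd1]; omega
    · by_cases hd2 : d 2 = 0
      · refine hF_hom.coeff_eq_zero ?_
        rw [Finsupp.degree_eq_sum, Fin.sum_univ_three, hd0, hd2]
        intro hdeg
        apply h1
        ext j
        fin_cases j <;> simp [hd0, hd2]; omega
      · -- both `y₁` and `y₂` occur: use `∂₂∂₁F = 0`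
        refine coeff_eq_zero_of_coeff_pderiv hd1 (coeff_eq_zero_of_coeff_pderiv (i := 2) ?_ ?_)
        · rwa [Finsupp.tsub_apply, Finsupp.single_apply, if_neg (by decide), tsub_zero]
        · rw [hF21, coeff_zero]
  -- Step 5: the 3-cycle acts as the twist `diag(1,ζ,ζ²)`, which fixes `F`.
  have htwist : bind₁ (fun j : Fin 3 => C (ζ ^ j.val) * X j) F = F := by
    rw [← linSubst_diagonal]
    apply MvPolynomial.funext
    intro y
    rw [eval_bind₁_linSubst, hF, eval_bind₁_linSubst, eval_bind₁_linSubst, hMdef, dft_mulVec_twist h3,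
      ← eval_rename, hpermc]
  have hcoeff_twist : ∀ d : Fin 3 →₀ ℕ, (∏ j : Fin 3, (ζ ^ j.val) ^ d j) * coeff d F = coeff d F := by
    intro d
    rw [← coeff_bind₁_diag, htwist]
  -- Step 6: `F = 0`.
  have hF_zero : F = 0 := by
    ext d
    rw [coeff_zero]
    by_cases h1 : d = Finsupp.single 1 n
    · subst h1
      have h := hcoeff_twist (Finsupp.single 1 n)
      simp only [Fin.prod_univ_three, Finsupp.single_apply] at h
      simp only [Fin.isValue, one_ne_zero, ↓reduceIte, pow_zero, Fin.val_one, pow_one, show (1 : Fin 3) ≠ 2 by decide,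
        mul_one, one_mul] at h
      -- `h : ζ ^ n * c = c`
      have hne : ζ ^ n - 1 ≠ 0 := sub_ne_zero.mpr (pow_ne_one_of_not_dvd hζ hn3)
      have : (ζ ^ n - 1) * coeff (Finsupp.single 1 n) F = 0 := by linear_combination h
      exact (mul_eq_zero.mp this).resolve_left hne
    by_cases h2 : d = Finsupp.single 2 n
    · subst h2
      have h := hcoeff_twist (Finsupp.single 2 n)
      simp only [Fin.prod_univ_three, Finsupp.single_apply] at h
      simp only [Fin.isValue, show (2 : Fin 3) ≠ 0 by decide, show (2 : Fin 3) ≠ 1 by decide, ↓reduceIte, pow_zero,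
        Fin.val_two, one_mul] at h
      -- `h : (ζ ^ 2) ^ n * c = c`
      have hn3' : ¬ 3 ∣ 2 * n := fun h => hn3 ((Nat.Coprime.dvd_mul_left (by norm_num)).mp h)
      have hne : ζ ^ (2 * n) - 1 ≠ 0 := sub_ne_zero.mpr (pow_ne_one_of_not_dvd hζ hn3')
      have : (ζ ^ (2 * n) - 1) * coeff (Finsupp.single 2 n) F = 0 := by
        rw [pow_mul]; linear_combination h
      exact (mul_eq_zero.mp this).resolve_left hne
    exact hcoeff d h1 h2
  -- Step 7: back to `Yc` (the substitution is invertible) and to `Y`.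
  have hYc0 : Yc = 0 := by
    apply MvPolynomial.funext
    intro x
    have hx : M.mulVec (((1 : ℂ) / 3) • (Matrix.of fun i j : Fin 3 => ζ ^ (2 * (i.val * j.val))).mulVec x) = x := by
      rw [Matrix.mulVec_smul, hMdef, dft_mulVec_dftInv h3 hs, smul_smul]
      norm_num
    rw [map_zero, ← hx, ← eval_bind₁_linSubst, ← hF, hF_zero, map_zero]
  have hmap : map Complex.ofRealHom Y = map Complex.ofRealHom 0 := by rw [map_zero]; exact hYc0
  exact map_injective _ Complex.ofReal_injective hmap

end Summit.QuantumFields.YangMills.Theorems.F4SubCurvatureDoorTorusTransverse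

end
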